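import Mathlib
import Summits.Ventures.HodgeRepro.Tier4.Common.AdelicDefs
import Summits.Ventures.HodgeRepro.Tier4.Line1.FiniteLevelIsolation
import Summits.Ventures.HodgeRepro.Tier4.Line4.TorusProduct

/-!
# Tier4/Line4/ProperDefs — the two DEFINITIONS of C-L4-PROPER / C-L4-INTEG shared by `OrbitProper` and `IntegProper`

Blind re-derivation cell `pub-hodge-repro`, Tier 4 «prove the step» (README §9–§10), seat t4-L2-p1 (gen 3; L4 service
prover).  Tree path `lean/Summits/Ventures/HodgeRepro/Tier4/Line4/ProperDefs.lean`.  A defs-only module so that the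
PROVER of C-L4-PROPER (t4-L2-p3, `Line4/OrbitProper`) and the consumer of its conclusion (C-L4-INTEG (B1) (C-hIfin) (D),
`Line4/IntegProper`; Part 9 `horb_of_integ` of plan-4's Integ-Concat-v2) import ONE declaration each instead of restating.

* `diagCentreFin` — BYTES VERBATIM from t4-L2-p3 g4's statement file proofs/t4-L2-p3/work/OrbitProper-STATEMENTS.lean
  (S14602): the diagonal centre `Δ(Z_f) ≤ T_f × T′_f`.
* `HasProperFinOrbit` — BYTES VERBATIM from t4-plan-4 g3's Integ-Concat-v2.lean efc313b641e3a2f3 Part 8 L483–L488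
  (S14649 / S14670): PROPER's conclusion as a predicate of `γ₀`.

Nothing here says anything about the status of the Hodge conjecture for CM abelian varieties, which is NOT proved
(HC_CM is NOT proved by anyone in this repository).
-/

set_option autoImplicit false
noncomputable section
namespace Summit.Ventures.HodgeRepro.Tier4.Line4
open Summit.Ventures.HodgeRepro.Tier4 Summit.Ventures.HodgeRepro.Tier4.Common
  Summit.Ventures.HodgeRepro.Tier4.Line1
open scoped Pointwise

variable {k : Type} [Field k] [NumberField k] (W : PlaneData k)

/-- **The diagonal centre `Δ(Z_f) ≤ T_f × T′_f`**: the pairs `(z, z)` with `z ∈ Z = T ∩ T′ ∩ Z(G)` (its finite part is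
automatic, `z ∈ T_f`). It acts on `T_f × T′_f` by right multiplication and fixes the orbit map:
`(b z)⁻¹ γ₀,f (b′ z) = b⁻¹ γ₀,f b′`. -/
def diagCentreFin : Set (torusFin W × torusFin' W) :=
  {q | ∃ z ∈ centre W, ((q.1 : torusT W) : GA W) = z ∧ ((q.2 : torusT' W) : GA W) = z}

/-- **PROPER's conclusion as a predicate of `γ₀`**: every compact `C ⊆ G(𝔸)` pulls back along
`(b, b′) ↦ b⁻¹ γ₀,f b′` into `C′ · Δ(Z_f)` with `C′` compact. -/
def HasProperFinOrbit (γ₀ : GA W) : Prop :=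
  ∀ C : Set (GA W), IsCompact C → ∃ C' : Set (torusFin W × torusFin' W), IsCompact C' ∧
    {p : torusFin W × torusFin' W |
      (((p.1 : torusT W) : GA W))⁻¹ * GA.ofFinPart W γ₀ * ((p.2 : torusT' W) : GA W) ∈ C} ⊆ C' * diagCentreFin W

/-- Sanity (L2-p3's example, S14602): the diagonal centre fixes the orbit map. -/
theorem orbit_mul_diagCentreFin (γ₀ : GA W) (p : torusFin W × torusFin' W) (q : torusFin W × torusFin' W)
    (hq : q ∈ diagCentreFin W) :
    (((p.1 * q.1 : torusFin W) : torusT W) : GA W)⁻¹ * GA.ofFinPart W γ₀ *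
        (((p.2 * q.2 : torusFin' W) : torusT' W) : GA W) =
      (((p.1 : torusT W) : GA W))⁻¹ * GA.ofFinPart W γ₀ * ((p.2 : torusT' W) : GA W) := by
  obtain ⟨z, hz, h1, h2⟩ := hq
  have hzc : ∀ g : GA W, z * g = g * z := fun g => (Subgroup.mem_center_iff.1 (centre_le_center W hz) g).symm
  simp only [Subgroup.coe_mul, h1, h2, mul_inv_rev]
  rw [← hzc ((p.2 : torusT' W) : GA W), ← mul_assoc,
    ← hzc (z⁻¹ * ((((p.1 : torusT W) : GA W))⁻¹) * GA.ofFinPart W γ₀), mul_assoc z⁻¹, mul_inv_cancel_left]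

end Summit.Ventures.HodgeRepro.Tier4.Line4

end
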